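import Mathlib
import Literature.NumberTheory.LFunctions.Zhang2022.Section17U021ChiR1Prelims
import Literature.NumberTheory.LFunctions.RosserSchoenfeldMertensFirstConstant
import Literature.NumberTheory.LFunctions.MertensElementary
import HarnessLib

/-!
# Zhang (2022) §17.u021 (χ-twisted reading), remainder `R₁`, prime window: the `q`-sum taken FIRST —
# `Ξ_β(b′) = Σ_{Y<q prime} κ̄₂(q) q^{−β} g*(T²/(qb′))/q = iβ₁·(log(T²/b′) − log Y) + O(α/𝓛)`

Topic `Literature/NumberTheory/LFunctions/Zhang2022` (Landau–Siegel audit tree; verdict-neutral).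
Y. Zhang, *Discrete mean estimates and the Landau–Siegel zero*, arXiv:2211.02515v1 (2022)
[Zhang2022LandauSiegel] — **an unrefereed manuscript under adjudication; nothing here asserts or denies
its Theorems 1–2, and no claim about Landau–Siegel zeros is made.** ZHANG-L discharge lane, WP16, R1-χ
sub-leaf under `Typed.Section17.Eq17_9RelE` (W16-S5d (F)), node `Typed.Section17.Step17_u021Chi`
(remainder `R₁`, the `m₂ ≥ 2` terms; §17 p. 98 tex L4825 "we can drop the terms with `m₂ > 1` … with an
acceptable error" — no bound in print). Companion of `Section17U021ChiR1Window` (the exact shape of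
`ν₁*(l₂q)` for a prime `q > D⁴`): once the `q`-sum is taken first, the window term of `R₁` at fixed
`(l₁, l₂)` is `A(l₁)·Σ_{b′c′=l₂} b′^{−β₂}ρ₃(c′)·Ξ_{β₂}(b′) + (2↔3)` with

  `Ξ_β(b′) := Σ_{q prime > Y} κ̄₂(q)·q^{−β}·g*(T²/(qb′))/q`,

and this file evaluates `Ξ_β(b′)`: `κ̄₂(q)q^{−β} = iβ₁ log q + O(α²log²q)` (`κ̄₂(q) = q^{ib₁} − 1`),
`g*(T²/(qb′)) = 𝟙_{q < T²/b′}` up to a sliver of relative width `𝓛⁻¹⁴` and tails `e^{−𝓛²}` ((4.2)/(4.3)),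
and MERTENS' FIRST THEOREM WITH RATE (`Σ_{p≤x} log p/p = log x + E + O(1/log x)`, the tree's
`abs_sum_primesLE_log_div_sub_log_sub_rosserSchoenfeldE_le`) give

  `Ξ_β(b′) = iβ₁·(log(T²/b′) − log Y) + O(α/𝓛)`   (`D⁴ ≤ Y`, `Yb′ ≤ T²/4`, `|β| ≤ 10α`, `Re β = 0`).

The `−iβ₁ log b′` part is what produces the `Λ`-type `l₂`-weight of the window (via
`Section17U021ChiR1Window.sum_divisorsAntidiagonal_mul_log_eq`); the `O(α/𝓛)` part is the bottleneck
error of the whole `R₁` estimate. Theorems only; no definitions; standard axioms.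

## References

* Y. Zhang, arXiv:2211.02515v1 (2022), §17 p. 98 (u021), tex L4825; §4 (4.2)–(4.3).
  [cite: Zhang2022LandauSiegel, §17 u021 p.98]
* J. B. Rosser, L. Schoenfeld, Illinois J. Math. 6 (1962), (2.31). [cite: RosserSchoenfeld1962, (2.31)]
-/

noncomputable section

open Complex Real Finset
open scoped LSeries.notation

namespace Literature.NumberTheory.LFunctions.Zhang2022.Typed.Section17

open Literature.NumberTheory.LFunctions.Zhang2022
open Literature.NumberTheory.LFunctions.Zhang2022.Skeleton
open Literature.NumberTheory.LFunctions.Zhang2022.MeanSquareMajorant (kappa₂ powI powI_apply_of_ne_zero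
  kappa₂_apply_prime)

/-! ## §1. Linearisation `κ̄₂(q)·q^{−it} = ib₁ log q + O((b₁² + t²) log² q)` -/

/-- `‖q^{iu} − q^{it} − i(u − t)log q‖ ≤ (u² + t²)·log²q` for `q ≥ 1`, `|u| log q ≤ 1`, `|t| log q ≤ 1`
(`e^{iθ} = 1 + iθ + O(θ²)`). [folklore] -/
private theorem norm_cpow_I_sub_cpow_I_sub_le {q : ℕ} (hq : q ≠ 0) {u t : ℝ}
    (hu : |u| * Real.log q ≤ 1) (ht : |t| * Real.log q ≤ 1) :
    ‖((q : ℂ) ^ ((u : ℂ) * I) - (q : ℂ) ^ ((t : ℂ) * I)) - ((u - t : ℝ) : ℂ) * I * Real.log q‖ ≤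
      (u ^ 2 + t ^ 2) * Real.log q ^ 2 := by
  have hq0 : (q : ℂ) ≠ 0 := by exact_mod_cast hq
  have hL : 0 ≤ Real.log q := Real.log_natCast_nonneg q
  have hexp : ∀ v : ℝ, (q : ℂ) ^ ((v : ℂ) * I) = Complex.exp (((v * Real.log q : ℝ) : ℂ) * I) := by
    intro v
    rw [Complex.cpow_def_of_ne_zero hq0, ← Complex.natCast_log]
    congr 1
    push_cast
    ring
  have hnorm : ∀ v : ℝ, ‖((v * Real.log q : ℝ) : ℂ) * I‖ = |v| * Real.log q := by
    intro v
    rw [norm_mul, Complex.norm_I, mul_one, Complex.norm_real, Real.norm_eq_abs, abs_mul,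
      abs_of_nonneg hL]
  have h1 := Complex.norm_exp_sub_one_sub_id_le (x := ((u * Real.log q : ℝ) : ℂ) * I)
    (by rw [hnorm]; exact hu)
  have h2 := Complex.norm_exp_sub_one_sub_id_le (x := ((t * Real.log q : ℝ) : ℂ) * I)
    (by rw [hnorm]; exact ht)
  rw [hnorm] at h1 h2
  have e : ((q : ℂ) ^ ((u : ℂ) * I) - (q : ℂ) ^ ((t : ℂ) * I)) - ((u - t : ℝ) : ℂ) * I * Real.log q =
      (Complex.exp (((u * Real.log q : ℝ) : ℂ) * I) - 1 - ((u * Real.log q : ℝ) : ℂ) * I) -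
        (Complex.exp (((t * Real.log q : ℝ) : ℂ) * I) - 1 - ((t * Real.log q : ℝ) : ℂ) * I) := by
    rw [hexp u, hexp t]
    push_cast
    ring
  rw [e]
  calc _ ≤ ‖Complex.exp (((u * Real.log q : ℝ) : ℂ) * I) - 1 - ((u * Real.log q : ℝ) : ℂ) * I‖ +
        ‖Complex.exp (((t * Real.log q : ℝ) : ℂ) * I) - 1 - ((t * Real.log q : ℝ) : ℂ) * I‖ :=
        norm_sub_le _ _
    _ ≤ (|u| * Real.log q) ^ 2 + (|t| * Real.log q) ^ 2 := add_le_add h1 h2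
    _ = (u ^ 2 + t ^ 2) * Real.log q ^ 2 := by rw [mul_pow, mul_pow, sq_abs, sq_abs]; ring

/-- **`κ̄₂(q) = q^{ib₁} − 1` at a prime `q`** (`κ̄₂ = κ₂^{(−b₁)}`, `TypedSection17Identities`).
[cite: Zhang2022LandauSiegel, §17 u016 p.97; App. A p.105] -/
theorem kappa2bar_apply_prime (c' : ℝ) (D : ℕ) {q : ℕ} (hq : q.Prime) :
    kappa2bar c' D q = (q : ℂ) ^ (((b1 c' D : ℝ) : ℂ) * I) - 1 := by
  rw [kappa2bar_eq_kappa₂_neg, kappa₂_apply_prime _ hq, powI_apply_of_ne_zero _ hq.ne_zero]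
  congr 2
  push_cast
  ring

/-- **`κ̄₂(q)·q^{−it} = ib₁ log q + O((|b₁|+|t|)² log² q)`** at a prime `q`, for real `t` with
`(|b₁|+|t|) log q ≤ 1` (in the chain `t = b₂` or `b₃`, `|t| ≤ 6α`, `log q ≤ 3𝓛^{1.1}`).
[cite: Zhang2022LandauSiegel, §17 u021 p.98] -/
theorem norm_kappa2bar_mul_cpow_sub_lin_le (c' : ℝ) (D : ℕ) {q : ℕ} (hq : q.Prime) {t : ℝ}
    (hsmall : (|b1 c' D| + |t|) * Real.log q ≤ 1) :
    ‖kappa2bar c' D q * (q : ℂ) ^ (-((t : ℂ) * I)) - ((b1 c' D : ℝ) : ℂ) * I * Real.log q‖ ≤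
      3 * (|b1 c' D| + |t|) ^ 2 * Real.log q ^ 2 := by
  have hq0 : (q : ℂ) ≠ 0 := by exact_mod_cast hq.ne_zero
  have hL : 0 ≤ Real.log q := Real.log_natCast_nonneg q
  set b := b1 c' D with hb
  -- `κ̄₂(q) q^{-it} = q^{i(b−t)} − q^{−it}`
  have e : kappa2bar c' D q * (q : ℂ) ^ (-((t : ℂ) * I)) =
      (q : ℂ) ^ (((b - t : ℝ) : ℂ) * I) - (q : ℂ) ^ (((-t : ℝ) : ℂ) * I) := by
    rw [kappa2bar_apply_prime c' D hq, sub_mul, one_mul, ← Complex.cpow_add _ _ hq0]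
    congr 2 <;> push_cast <;> ring
  have hu : |b - t| * Real.log q ≤ 1 := by
    have : |b - t| ≤ |b| + |t| := abs_sub b t
    nlinarith
  have ht : |(-t)| * Real.log q ≤ 1 := by
    rw [abs_neg]
    have : |t| ≤ |b| + |t| := by linarith [abs_nonneg b]
    nlinarith
  have h := norm_cpow_I_sub_cpow_I_sub_le hq.ne_zero hu ht
  have e2 : ((b - t - -t : ℝ) : ℂ) * I * Real.log q = ((b : ℝ) : ℂ) * I * Real.log q := by
    congr 2; push_cast; ring
  rw [e2] at h
  rw [e]
  refine h.trans ?_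
  have h3 : (b - t) ^ 2 + (-t) ^ 2 ≤ 3 * (|b| + |t|) ^ 2 := by
    nlinarith [abs_nonneg b, abs_nonneg t, sq_abs b, sq_abs t, abs_mul_abs_self b,
      abs_sub b t, neg_abs_le b, le_abs_self b, neg_abs_le t, le_abs_self t]
  exact mul_le_mul_of_nonneg_right h3 (sq_nonneg _)

/-! ## §2. Mertens' first theorem on a window -/

/-- Prime sums on `(a, b]` as differences of `primesLE` sums. [folklore] -/
private theorem sum_filter_prime_Ioc_eq_sub (f : ℕ → ℝ) {a b : ℕ} (hab : a ≤ b) :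
    ∑ p ∈ (Finset.Ioc a b).filter Nat.Prime, f p =
      (∑ p ∈ Nat.primesLE b, f p) - ∑ p ∈ Nat.primesLE a, f p := by
  rw [eq_sub_iff_add_eq, Nat.primesLE_eq_filter_range, Nat.primesLE_eq_filter_range,
    ← Finset.sum_union]
  · congr 1
    rw [← Finset.filter_union]
    congr 1
    ext x
    simp only [Finset.mem_union, Finset.mem_Ioc, Finset.mem_range]
    omega
  · refine Finset.disjoint_filter_filter (Finset.disjoint_left.mpr fun x hx hx' => ?_)
    simp only [Finset.mem_Ioc, Finset.mem_range] at hx hx'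
    omega

/-- **Mertens' first theorem on a window, with rate**: there is `K` with
`|Σ_{y<p≤x} log p/p − (log x − log y)| ≤ K/log x + K/log y` for all `2 ≤ y ≤ x`
(the tree's `abs_sum_primesLE_log_div_sub_log_sub_rosserSchoenfeldE_le 1`, twice).
[cite: RosserSchoenfeld1962, (2.31)] -/
theorem mertens_window : ∃ K : ℝ, 0 ≤ K ∧ ∀ y x : ℝ, 2 ≤ y → y ≤ x →
    |(∑ p ∈ (Finset.Ioc ⌊y⌋₊ ⌊x⌋₊).filter Nat.Prime, Real.log p / p) - (Real.log x - Real.log y)| ≤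
      K / Real.log x + K / Real.log y := by
  obtain ⟨K, hK⟩ := Literature.NumberTheory.LFunctions.abs_sum_primesLE_log_div_sub_log_sub_rosserSchoenfeldE_le 1
  have hK0 : 0 ≤ K := by
    have h := hK 2 le_rfl
    have hl : 0 < Real.log 2 := Real.log_pos one_lt_two
    have : 0 ≤ K / Real.log 2 ^ 1 := (abs_nonneg _).trans h
    rw [pow_one] at this
    exact (div_nonneg_iff.mp this).elim (fun h => h.1) (fun h => absurd h.2 (not_le.mpr hl))
  refine ⟨K, hK0, fun y x hy hyx => ?_⟩
  have hx := hK x (hy.trans hyx)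
  have hy' := hK y hy
  rw [pow_one] at hx hy'
  rw [sum_filter_prime_Ioc_eq_sub _ (Nat.floor_le_floor hyx)]
  have e : (∑ p ∈ Nat.primesLE ⌊x⌋₊, Real.log p / p) - (∑ p ∈ Nat.primesLE ⌊y⌋₊, Real.log p / p) -
      (Real.log x - Real.log y) =
      ((∑ p ∈ Nat.primesLE ⌊x⌋₊, Real.log p / p) - Real.log x - rosserSchoenfeldE) -
        ((∑ p ∈ Nat.primesLE ⌊y⌋₊, Real.log p / p) - Real.log y - rosserSchoenfeldE) := by ring
  rw [e]
  exact (abs_sub _ _).trans (add_le_add hx hy')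


/-! ## §3. Sizes at large `D` -/

/-- `|b₁| ≤ (1+5|c′|π)·α` once `𝓛 ≥ 1` (`b₁ = α(1 − 5c′α𝓛)`, `α𝓛 = π𝓛⁻⁸ ≤ π`).
[cite: Zhang2022LandauSiegel, §2 (2.13)] -/
theorem abs_b1_le_const_mul_alpha (c' : ℝ) {D : ℕ} (hℓ : 1 ≤ ell D) :
    |b1 c' D| ≤ (1 + 5 * |c'| * π) * alpha D := by
  have hℓ0 : 0 < ell D := by linarith
  have hα : alpha D = π / ell D ^ 9 := by rw [alpha, bigP, Real.log_exp]
  have hα0 : 0 < alpha D := by rw [hα]; positivity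
  have hαℓ : alpha D * ell D ≤ π := by
    rw [hα, div_mul_eq_mul_div, div_le_iff₀ (by positivity)]
    have : ell D ≤ ell D ^ 9 := by
      calc ell D = ell D ^ 1 := (pow_one _).symm
        _ ≤ ell D ^ 9 := pow_le_pow_right₀ hℓ (by norm_num)
    nlinarith [Real.pi_pos]
  rw [b1, abs_mul, abs_of_pos hα0]
  have h : |1 - 5 * c' * alpha D * ell D| ≤ 1 + 5 * |c'| * π := by
    calc |1 - 5 * c' * alpha D * ell D| ≤ |(1 : ℝ)| + |5 * c' * alpha D * ell D| := abs_sub _ _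
      _ = 1 + 5 * |c'| * (alpha D * ell D) := by
          rw [abs_one, show 5 * c' * alpha D * ell D = 5 * c' * (alpha D * ell D) by ring, abs_mul,
            abs_mul, abs_of_nonneg (by positivity : (0 : ℝ) ≤ alpha D * ell D)]
          norm_num
      _ ≤ 1 + 5 * |c'| * π := by gcongr
  calc alpha D * |1 - 5 * c' * alpha D * ell D| ≤ alpha D * (1 + 5 * |c'| * π) :=
        mul_le_mul_of_nonneg_left h hα0.le
    _ = (1 + 5 * |c'| * π) * alpha D := mul_comm _ _

/-- `Σ_{p ≤ N} 1/p ≤ log N + 4` for `N ≥ 2` (from the tree's Mertens bound `log log N + 4` and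
`log x ≤ x`). [folklore] -/
private theorem sum_inv_prime_le_log (N : ℕ) (hN : 2 ≤ N) :
    ∑ p ∈ Nat.primesLE N, (1 : ℝ) / p ≤ Real.log N + 4 := by
  have h := Literature.NumberTheory.LFunctions.MertensBound.sum_inv_prime_le N hN
  have hlog : Real.log (Real.log N) ≤ Real.log N := by
    have hN1 : (1 : ℝ) < N := by exact_mod_cast hN
    have h0 : 0 < Real.log N := Real.log_pos hN1
    linarith [Real.log_le_sub_one_of_pos h0]
  linarith

/-- A window sum of nonnegative prime terms is at most the full sum up to the top. [folklore] -/
private theorem sum_filter_prime_Ioc_le_primesLE {f : ℕ → ℝ} (hf : ∀ p, 0 ≤ f p) (a b : ℕ) :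
    ∑ p ∈ (Finset.Ioc a b).filter Nat.Prime, f p ≤ ∑ p ∈ Nat.primesLE b, f p := by
  refine Finset.sum_le_sum_of_subset_of_nonneg ?_ (fun p _ _ => hf p)
  intro p hp
  simp only [Finset.mem_filter, Finset.mem_Ioc] at hp
  rw [Nat.primesLE_eq_filter_range, Finset.mem_filter, Finset.mem_range]
  exact ⟨by omega, hp.2⟩


/-- `𝓛 = log D ≥ M` for all `D ≥ ⌈e^M⌉`. [folklore] -/
private theorem exists_nat_le_ell' (M : ℝ) : ∃ D₀ : ℕ, ∀ D : ℕ, D₀ ≤ D → M ≤ ell D := by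
  refine ⟨⌈Real.exp M⌉₊, fun D hD => ?_⟩
  have h1 : Real.exp M ≤ D := (Nat.le_ceil _).trans (by exact_mod_cast hD)
  have hD0 : (0 : ℝ) < D := lt_of_lt_of_le (Real.exp_pos M) h1
  calc M = Real.log (Real.exp M) := (Real.log_exp M).symm
    _ ≤ Real.log D := Real.log_le_log (Real.exp_pos M) h1
    _ = ell D := rfl

/-! ## §4. The window `q`-sum `Ξ_β(b)` -/

/-- Per-prime facts in the window: for a prime `q` with `log q ≤ L`, `Re β = 0`, `|b₁| + |Im β|` small,
`‖κ̄₂(q)q^{−β}‖ ≤ |b₁| log q`, `‖κ̄₂(q)q^{−β}‖ ≤ 2`, and the linearisation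
`‖κ̄₂(q)q^{−β} − ib₁ log q‖ ≤ 3(|b₁|+|Im β|)² log²q`. [cite: Zhang2022LandauSiegel, §17 u021 p.98] -/
theorem window_term_facts (c' : ℝ) (D : ℕ) {β : ℂ} (hβ : β.re = 0) {q : ℕ} (hq : q.Prime)
    (hsmall : (|b1 c' D| + |β.im|) * Real.log q ≤ 1) :
    ‖kappa2bar c' D q * (q : ℂ) ^ (-β)‖ ≤ |b1 c' D| * Real.log q ∧
      ‖kappa2bar c' D q * (q : ℂ) ^ (-β)‖ ≤ 2 ∧
      ‖kappa2bar c' D q * (q : ℂ) ^ (-β) - ((b1 c' D : ℝ) : ℂ) * I * Real.log q‖ ≤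
        3 * (|b1 c' D| + |β.im|) ^ 2 * Real.log q ^ 2 := by
  have hβI : β = (β.im : ℂ) * I := by apply Complex.ext <;> simp [hβ]
  have hpow : ‖(q : ℂ) ^ (-β)‖ = 1 := by
    rw [Complex.norm_natCast_cpow_of_pos hq.pos]; simp [hβ]
  have hk : ‖kappa2bar c' D q‖ ≤ |b1 c' D| * Real.log q := by
    rw [kappa2bar_eq_kappa₂_neg]
    have h := MeanSquareMajorant.norm_kappa₂_prime_le (-(b1 c' D)) hq
    rwa [abs_neg] at h
  have hk2 : ‖kappa2bar c' D q‖ ≤ 2 := by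
    rw [kappa2bar_eq_kappa₂_neg]
    exact MeanSquareMajorant.norm_kappa₂_prime_le_two _ hq
  refine ⟨by rw [norm_mul, hpow, mul_one]; exact hk, by rw [norm_mul, hpow, mul_one]; exact hk2, ?_⟩
  have h := norm_kappa2bar_mul_cpow_sub_lin_le c' D hq (t := β.im) hsmall
  have e : -β = -((β.im : ℂ) * I) := by rw [← hβI]
  rw [e]
  exact h

/-- **The window `q`-sum, evaluated** (MEMO-R1-window §2(iv)/§3): for `D` large, `Re β = 0`,
`|β| ≤ 10α`, `1 ≤ b ≤ D⁴`, `D⁴ ≤ Y`, `4Yb ≤ T²` and `N ≥ 2T²`,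
`‖Σ_{Y < q ≤ N, q prime} κ̄₂(q)·q^{−β}·g*(T²/(qb))/q − ib₁·(log(T²/b) − log Y)‖ ≤ C·α`.
Three ranges: `q ≤ X/2` (`X = T²/b`; `g* = 1 + O(e^{−𝓛³⁰log²2})` by (4.2), linearisation
`κ̄₂(q)q^{−β} = ib₁log q + O(α²log²q)`, Mertens with rate), `X/2 < q ≤ 2X` (`|κ̄₂(q)| ≤ |b₁|log q` and
Mertens: `Σ log q/q = log 4 + O(1)`), `q > 2X` (`g* = 0`). [cite: Zhang2022LandauSiegel, §17 u021 p.98] -/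
theorem xi_window_estimate (c' : ℝ) : ∃ C : ℝ, ∃ D₀ : ℕ, ∀ D : ℕ, D₀ ≤ D →
    ∀ β : ℂ, β.re = 0 → ‖β‖ ≤ 10 * alpha D →
    ∀ b : ℕ, 1 ≤ b → (b : ℝ) ≤ (D : ℝ) ^ 4 →
    ∀ Y : ℝ, (D : ℝ) ^ 4 ≤ Y → 4 * (Y * b) ≤ bigT D ^ 2 →
    ∀ N : ℕ, 2 * bigT D ^ 2 ≤ (N : ℝ) →
      ‖(∑ q ∈ (Finset.Ioc ⌊Y⌋₊ N).filter Nat.Prime,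
          kappa2bar c' D q * (q : ℂ) ^ (-β) * (gstar D (bigT D ^ 2 / ((q * b : ℕ) : ℝ)) : ℂ) /
            (q : ℂ)) -
        ((b1 c' D : ℝ) : ℂ) * I * ((Real.log (bigT D ^ 2 / b) - Real.log Y : ℝ) : ℂ)‖ ≤
      C * alpha D := by
  classical
  obtain ⟨K, hK0, hK⟩ := mertens_window
  set B₁ : ℝ := 1 + 5 * |c'| * π with hB₁
  set A₀ : ℝ := B₁ + 10 with hA₀
  have hB₁0 : 1 ≤ B₁ := by rw [hB₁]; nlinarith [abs_nonneg c', Real.pi_pos]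
  have hA₀0 : 11 ≤ A₀ := by rw [hA₀]; linarith only [hB₁0]
  have hA₀pos : (0 : ℝ) ≤ A₀ := by linarith only [hA₀0]
  obtain ⟨D₁, hD₁⟩ := exists_nat_le_ell' (max 3 (max (2 * π * A₀) (48 * π * A₀ ^ 2)))
  refine ⟨B₁ * (3 + 2 * K) + 2, max D₁ 2, fun D hD β hβre hβ b hb hbD Y hY hYb N hN => ?_⟩
  -- sizes of `D`
  have hD₁' : D₁ ≤ D := le_trans (le_max_left _ _) hD
  have hD2 : 2 ≤ D := le_trans (le_max_right _ _) hD
  have hℓM := hD₁ D hD₁'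
  have hℓ3 : 3 ≤ ell D := le_trans (le_max_left _ _) hℓM
  have hℓA : 2 * π * A₀ ≤ ell D := le_trans (le_trans (le_max_left _ _) (le_max_right _ _)) hℓM
  have hℓB : 48 * π * A₀ ^ 2 ≤ ell D := le_trans (le_trans (le_max_right _ _) (le_max_right _ _)) hℓM
  have hℓ1 : 1 ≤ ell D := by linarith
  have hℓ0 : 0 < ell D := by linarith
  have hα : alpha D = π / ell D ^ 9 := by rw [alpha, bigP, Real.log_exp]
  have hα0 : 0 < alpha D := by rw [hα]; positivity
  have hπ3 := Real.pi_gt_three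
  -- `L₁ = 𝓛^{1.1}`, `T = e^{L₁}`
  set L₁ : ℝ := ell D ^ (1.1 : ℝ) with hL₁
  have hL₁ℓ : ell D ≤ L₁ := by
    rw [hL₁]
    calc ell D = ell D ^ (1 : ℝ) := (Real.rpow_one _).symm
      _ ≤ ell D ^ (1.1 : ℝ) := Real.rpow_le_rpow_of_exponent_le hℓ1 (by norm_num)
  have hL₁2 : L₁ ≤ ell D ^ 2 := by
    rw [hL₁]
    calc ell D ^ (1.1 : ℝ) ≤ ell D ^ (2 : ℝ) := Real.rpow_le_rpow_of_exponent_le hℓ1 (by norm_num)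
      _ = ell D ^ 2 := by norm_cast
  have hL₁0 : 0 < L₁ := lt_of_lt_of_le hℓ0 hL₁ℓ
  have hT : bigT D = Real.exp L₁ := rfl
  have hT0 : 0 < bigT D := Real.exp_pos _
  have hlogT2 : Real.log (bigT D ^ 2) = 2 * L₁ := by rw [Real.log_pow, hT, Real.log_exp]; ring
  -- `X = T²/b`
  have hb0 : (0 : ℝ) < b := by exact_mod_cast hb
  set X : ℝ := bigT D ^ 2 / b with hX
  have hX0 : 0 < X := div_pos (pow_pos hT0 2) hb0
  have hXT : X ≤ bigT D ^ 2 := div_le_self (pow_pos hT0 2).le (by exact_mod_cast hb)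
  have hXY : 4 * Y ≤ X := by rw [hX, le_div_iff₀ hb0]; linarith
  have hD4 : (16 : ℝ) ≤ (D : ℝ) ^ 4 := by
    have : (2 : ℝ) ≤ D := by exact_mod_cast hD2
    calc (16 : ℝ) = 2 ^ 4 := by norm_num
      _ ≤ (D : ℝ) ^ 4 := pow_le_pow_left₀ (by norm_num) this 4
  have hY16 : 16 ≤ Y := hD4.trans hY
  have hlogY : 4 * ell D ≤ Real.log Y := by
    have : Real.log ((D : ℝ) ^ 4) = 4 * ell D := by rw [Real.log_pow]; simp [ell]
    rw [← this]; exact Real.log_le_log (by positivity) hY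
  have hlogX : Real.log X ≤ 2 * L₁ := by rw [← hlogT2]; exact Real.log_le_log hX0 hXT
  -- the three cut points
  set a₀ : ℕ := ⌊Y⌋₊ with ha₀
  set a₁ : ℕ := ⌊X / 2⌋₊ with ha₁
  set a₂ : ℕ := ⌊2 * X⌋₊ with ha₂
  have h01 : a₀ ≤ a₁ := Nat.floor_le_floor (by linarith)
  have h12 : a₁ ≤ a₂ := Nat.floor_le_floor (by linarith)
  have h2N : a₂ ≤ N := by
    rw [ha₂, ← Nat.floor_natCast (R := ℝ) N]; exact Nat.floor_le_floor (by linarith)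
  have ha₁2 : 2 ≤ a₁ := Nat.le_floor (by push_cast; linarith)
  -- the summand
  set F : ℕ → ℂ := fun q => kappa2bar c' D q * (q : ℂ) ^ (-β) *
    (gstar D (bigT D ^ 2 / ((q * b : ℕ) : ℝ)) : ℂ) / (q : ℂ) with hF
  have harg : ∀ q : ℕ, bigT D ^ 2 / ((q * b : ℕ) : ℝ) = X / q := by
    intro q; rw [hX, Nat.cast_mul, div_div, mul_comm]
  -- split the range
  have hsplit : (Finset.Ioc a₀ N).filter Nat.Prime =
      ((Finset.Ioc a₀ a₁).filter Nat.Prime ∪ (Finset.Ioc a₁ a₂).filter Nat.Prime) ∪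
        (Finset.Ioc a₂ N).filter Nat.Prime := by
    rw [← Finset.filter_union, ← Finset.filter_union, Finset.Ioc_union_Ioc_eq_Ioc h01 h12,
      Finset.Ioc_union_Ioc_eq_Ioc (h01.trans h12) h2N]
  have hdisj1 : Disjoint ((Finset.Ioc a₀ a₁).filter Nat.Prime) ((Finset.Ioc a₁ a₂).filter Nat.Prime) :=
    Finset.disjoint_filter_filter (Finset.Ioc_disjoint_Ioc_of_le le_rfl)
  have hdisj2 : Disjoint ((Finset.Ioc a₀ a₁).filter Nat.Prime ∪ (Finset.Ioc a₁ a₂).filter Nat.Prime)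
      ((Finset.Ioc a₂ N).filter Nat.Prime) := by
    rw [← Finset.filter_union, Finset.Ioc_union_Ioc_eq_Ioc h01 h12]
    exact Finset.disjoint_filter_filter (Finset.Ioc_disjoint_Ioc_of_le le_rfl)
  rw [hsplit, Finset.sum_union hdisj2, Finset.sum_union hdisj1]
  -- §R3: `q > 2X` ⇒ `g* = 0`
  have hS₃ : ∑ q ∈ (Finset.Ioc a₂ N).filter Nat.Prime, F q = 0 := by
    refine Finset.sum_eq_zero fun q hq => ?_
    simp only [Finset.mem_filter, Finset.mem_Ioc] at hq
    have hq2X : 2 * X < q := (Nat.floor_lt (by linarith only [hX0])).mp hq.1.1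
    have hq0 : (0 : ℝ) < q := by exact_mod_cast hq.2.pos
    have hle : ¬ (1 / 2 : ℝ) < X / q := by
      rw [not_lt, div_le_iff₀ hq0]; linarith only [hq2X]
    simp only [hF, harg q, gstar, hle, if_false, Complex.ofReal_zero, mul_zero, zero_div]
  -- per-prime facts
  have hb1 : |b1 c' D| ≤ B₁ * alpha D := abs_b1_le_const_mul_alpha c' hℓ1
  have hβim : |β.im| ≤ 10 * alpha D := (Complex.abs_im_le_norm β).trans hβ
  have hA : |b1 c' D| + |β.im| ≤ A₀ * alpha D := by rw [hA₀]; linarith only [hb1, hβim]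
  have hAsmall : A₀ * alpha D * (2 * L₁) ≤ 1 := by
    -- `A₀ π/𝓛⁹ · 2𝓛² ≤ 2πA₀/𝓛 ≤ 1`
    rw [hα]
    have h9 : ell D ^ 2 * ell D ≤ ell D ^ 9 := by
      calc ell D ^ 2 * ell D = ell D ^ 3 := by ring
        _ ≤ ell D ^ 9 := pow_le_pow_right₀ hℓ1 (by norm_num)
    calc A₀ * (π / ell D ^ 9) * (2 * L₁) ≤ A₀ * (π / ell D ^ 9) * (2 * ell D ^ 2) := by
          gcongr
      _ = (2 * π * A₀) * ell D ^ 2 / ell D ^ 9 := by ring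
      _ ≤ ell D * ell D ^ 2 / ell D ^ 9 := by gcongr
      _ ≤ 1 := by
          rw [div_le_one (by positivity)]; linarith only [h9]
  -- `g*` facts
  have hΛ : (0 : ℝ) < ell D ^ 30 := pow_pos hℓ0 30
  have hg1 : ∀ y : ℝ, |gstar D y| ≤ 1 := by
    intro y
    by_cases hy : 1 / 2 < y
    · rw [gstar, if_pos hy, gW]
      have h0 := GaussWeight.gWeight_pos hΛ y
      have h1 := GaussWeight.gWeight_lt_one hΛ y
      rw [abs_of_pos h0]; exact h1.le
    · rw [gstar, if_neg hy, abs_zero]; exact zero_le_one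
  set dlt : ℝ := (1 / 2) * Real.exp (-(ell D ^ 30) * Real.log 2 ^ 2) with hdlt
  have hdlt0 : 0 ≤ dlt := mul_nonneg (by norm_num) (Real.exp_pos _).le
  have hgR1 : ∀ q : ℕ, (0 : ℝ) < q → (q : ℝ) ≤ X / 2 → |gstar D (X / q) - 1| ≤ dlt := by
    intro q hq0 hqX
    have hXq : 2 ≤ X / q := by rw [le_div_iff₀ hq0]; linarith only [hqX]
    rw [gstar, if_pos (by linarith only [hXq]), gW]
    refine (GaussWeight.abs_gWeight_sub_one_le hΛ (by linarith only [hXq])).trans ?_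
    rw [hdlt]
    gcongr (1 / 2) * Real.exp ?_
    have hlog2 : Real.log 2 ≤ Real.log (X / q) := Real.log_le_log (by norm_num) hXq
    have hl0 : 0 ≤ Real.log 2 := Real.log_nonneg (by norm_num)
    have hsq := mul_self_le_mul_self hl0 hlog2
    nlinarith only [hsq, hΛ]
  -- per-prime facts on `(a₀, a₁]` and `(a₁, a₂]`
  have hmemR1 : ∀ q ∈ (Finset.Ioc a₀ a₁).filter Nat.Prime,
      q.Prime ∧ (0 : ℝ) < q ∧ (q : ℝ) ≤ X / 2 ∧ Real.log q ≤ 2 * L₁ ∧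
        (|b1 c' D| + |β.im|) * Real.log q ≤ 1 := by
    intro q hq
    simp only [Finset.mem_filter, Finset.mem_Ioc] at hq
    have hqp := hq.2
    have hq0 : (0 : ℝ) < q := by exact_mod_cast hqp.pos
    have hqX : (q : ℝ) ≤ X / 2 :=
      le_trans (by exact_mod_cast hq.1.2) (Nat.floor_le (by linarith only [hX0]))
    have hlq : Real.log q ≤ 2 * L₁ :=
      (Real.log_le_log hq0 (by linarith only [hqX, hX0])).trans hlogX
    have hlq0 : 0 ≤ Real.log q := Real.log_natCast_nonneg q
    refine ⟨hqp, hq0, hqX, hlq, ?_⟩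
    calc (|b1 c' D| + |β.im|) * Real.log q ≤ (A₀ * alpha D) * (2 * L₁) :=
          mul_le_mul hA hlq hlq0 (mul_nonneg hA₀pos hα0.le)
      _ ≤ 1 := hAsmall
  have hmemR2 : ∀ q ∈ (Finset.Ioc a₁ a₂).filter Nat.Prime,
      q.Prime ∧ (0 : ℝ) < q ∧ (|b1 c' D| + |β.im|) * Real.log q ≤ 1 := by
    intro q hq
    simp only [Finset.mem_filter, Finset.mem_Ioc] at hq
    have hqp := hq.2
    have hq0 : (0 : ℝ) < q := by exact_mod_cast hqp.pos
    have hq2X : (q : ℝ) ≤ 2 * X :=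
      le_trans (by exact_mod_cast hq.1.2) (Nat.floor_le (by linarith only [hX0]))
    have hlq : Real.log q ≤ 2 * L₁ + 1 := by
      calc Real.log q ≤ Real.log (2 * X) := Real.log_le_log hq0 hq2X
        _ = Real.log 2 + Real.log X := Real.log_mul (by norm_num) hX0.ne'
        _ ≤ 2 * L₁ + 1 := by linarith only [Real.log_two_lt_d9, hlogX]
    have hlq0 : 0 ≤ Real.log q := Real.log_natCast_nonneg q
    refine ⟨hqp, hq0, ?_⟩
    -- `A₀α(2L₁+1) ≤ A₀α·3L₁ ≤ 1` needs a little more room than `hAsmall`; use `L₁ ≥ 𝓛 ≥ 3`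
    have h3 : 2 * L₁ + 1 ≤ 3 * L₁ := by linarith only [hL₁ℓ, hℓ3]
    have hA3 : A₀ * alpha D * (3 * L₁) ≤ 1 := by
      have h3pa : 3 * π * A₀ ≤ ell D * ell D :=
        calc 3 * π * A₀ ≤ 3 * (2 * π * A₀) := by nlinarith only [Real.pi_pos, hA₀0]
          _ ≤ 3 * ell D := by linarith only [hℓA]
          _ ≤ ell D * ell D := mul_le_mul_of_nonneg_right hℓ3 hℓ0.le
      rw [hα]
      calc A₀ * (π / ell D ^ 9) * (3 * L₁) ≤ A₀ * (π / ell D ^ 9) * (3 * ell D ^ 2) := by gcongr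
        _ = (3 * π * A₀) * ell D ^ 2 / ell D ^ 9 := by ring
        _ ≤ (ell D * ell D) * ell D ^ 2 / ell D ^ 9 :=
            div_le_div_of_nonneg_right (mul_le_mul_of_nonneg_right h3pa (by positivity))
              (by positivity)
        _ ≤ 1 := by
            rw [div_le_one (pow_pos hℓ0 9)]
            calc ell D * ell D * ell D ^ 2 = ell D ^ 4 := by ring
              _ ≤ ell D ^ 9 := pow_le_pow_right₀ hℓ1 (by norm_num)
    calc (|b1 c' D| + |β.im|) * Real.log q ≤ (A₀ * alpha D) * (3 * L₁) :=
          mul_le_mul hA (hlq.trans h3) hlq0 (mul_nonneg hA₀pos hα0.le)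
      _ ≤ 1 := hA3
  -- §R2: `‖S₂‖ ≤ |b₁|(2 + K)`
  have hS₂ : ‖∑ q ∈ (Finset.Ioc a₁ a₂).filter Nat.Prime, F q‖ ≤ |b1 c' D| * (2 + K) := by
    have hper : ∀ q ∈ (Finset.Ioc a₁ a₂).filter Nat.Prime, ‖F q‖ ≤ |b1 c' D| * (Real.log q / q) := by
      intro q hq
      obtain ⟨hqp, hq0, hsm⟩ := hmemR2 q hq
      obtain ⟨hk, -, -⟩ := window_term_facts c' D hβre hqp hsm
      have hqn : ‖(q : ℂ)‖ = q := by simp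
      rw [hF]
      dsimp only
      rw [norm_div, norm_mul, hqn, harg q, Complex.norm_real, Real.norm_eq_abs]
      calc ‖kappa2bar c' D q * (q : ℂ) ^ (-β)‖ * |gstar D (X / q)| / q
          ≤ |b1 c' D| * Real.log q * 1 / q := by gcongr; exact hg1 _
        _ = |b1 c' D| * (Real.log q / q) := by ring
    have hmert := hK (X / 2) (2 * X) (by linarith only [hXY, hY16]) (by linarith only [hX0])
    have hlog4 : Real.log (2 * X) - Real.log (X / 2) = Real.log 4 := by
      rw [Real.log_mul (by norm_num) hX0.ne', Real.log_div hX0.ne' (by norm_num),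
        show (4 : ℝ) = 2 * 2 by norm_num, Real.log_mul (by norm_num) (by norm_num)]
      ring
    have hl4 : Real.log 4 ≤ 2 := by
      rw [show (4 : ℝ) = 2 * 2 by norm_num, Real.log_mul (by norm_num) (by norm_num)]
      linarith only [Real.log_two_lt_d9]
    have hlogX2 : 2 ≤ Real.log (X / 2) := by
      have h16X : Real.log 16 ≤ Real.log (X / 2) :=
        Real.log_le_log (by norm_num) (by linarith only [hXY, hY16])
      have h16 : Real.log 16 = 4 * Real.log 2 := by
        rw [show (16 : ℝ) = 2 ^ 4 by norm_num, Real.log_pow]; norm_num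
      linarith only [Real.log_two_gt_d9, h16X, h16]
    have hlog2X : 2 ≤ Real.log (2 * X) := by
      have h40 : 0 ≤ Real.log 4 := Real.log_nonneg (by norm_num)
      linarith only [hlog4, h40, hlogX2]
    have hwin : ∑ p ∈ (Finset.Ioc a₁ a₂).filter Nat.Prime, Real.log p / p ≤ 2 + K := by
      have h := (abs_le.mp hmert).2
      rw [hlog4] at h
      have hK1 : K / Real.log (2 * X) ≤ K / 2 := div_le_div_of_nonneg_left hK0 (by norm_num) hlog2X
      have hK2 : K / Real.log (X / 2) ≤ K / 2 := div_le_div_of_nonneg_left hK0 (by norm_num) hlogX2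
      rw [ha₁, ha₂]
      linarith only [h, hK1, hK2, hl4]
    calc ‖∑ q ∈ (Finset.Ioc a₁ a₂).filter Nat.Prime, F q‖
        ≤ ∑ q ∈ (Finset.Ioc a₁ a₂).filter Nat.Prime, ‖F q‖ := norm_sum_le _ _
      _ ≤ ∑ q ∈ (Finset.Ioc a₁ a₂).filter Nat.Prime, |b1 c' D| * (Real.log q / q) :=
          Finset.sum_le_sum hper
      _ = |b1 c' D| * ∑ q ∈ (Finset.Ioc a₁ a₂).filter Nat.Prime, Real.log q / q := by
          rw [Finset.mul_sum]
      _ ≤ |b1 c' D| * (2 + K) := mul_le_mul_of_nonneg_left hwin (abs_nonneg _)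
  -- §R1: decomposition of the summand
  set R1 := (Finset.Ioc a₀ a₁).filter Nat.Prime with hR1
  have hsplit1 : ∀ q ∈ R1, F q =
      ((b1 c' D : ℝ) : ℂ) * I * ((Real.log q / q : ℝ) : ℂ) +
      ((kappa2bar c' D q * (q : ℂ) ^ (-β) - ((b1 c' D : ℝ) : ℂ) * I * Real.log q) / (q : ℂ) +
        kappa2bar c' D q * (q : ℂ) ^ (-β) * (((gstar D (X / q) - 1 : ℝ)) : ℂ) / (q : ℂ)) := by
    intro q hq
    obtain ⟨hqp, hq0, -, -, -⟩ := hmemR1 q hq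
    have hq0' : (q : ℂ) ≠ 0 := by exact_mod_cast hqp.ne_zero
    rw [hF]
    dsimp only
    rw [harg q]
    push_cast
    field_simp
    ring
  have hsum1 : ∑ q ∈ R1, F q =
      ((b1 c' D : ℝ) : ℂ) * I * ((∑ q ∈ R1, Real.log q / q : ℝ) : ℂ) +
      (∑ q ∈ R1, (kappa2bar c' D q * (q : ℂ) ^ (-β) - ((b1 c' D : ℝ) : ℂ) * I * Real.log q) / (q : ℂ) +
        ∑ q ∈ R1, kappa2bar c' D q * (q : ℂ) ^ (-β) * (((gstar D (X / q) - 1 : ℝ)) : ℂ) / (q : ℂ)) := by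
    rw [Finset.sum_congr rfl hsplit1, Finset.sum_add_distrib, Finset.sum_add_distrib,
      Complex.ofReal_sum, Finset.mul_sum]
  -- the harmonic-type bound `Σ_{q ∈ R1} 1/q ≤ 2L₁ + 4`
  have hH : ∑ q ∈ R1, (1 : ℝ) / q ≤ 2 * L₁ + 4 := by
    have h1 := sum_filter_prime_Ioc_le_primesLE (f := fun p : ℕ => (1 : ℝ) / p)
      (fun p => by positivity) a₀ a₁
    have h2 := sum_inv_prime_le_log a₁ ha₁2
    have h3 : Real.log a₁ ≤ 2 * L₁ := by
      have ha₁0 : (0 : ℝ) < a₁ := by exact_mod_cast (lt_of_lt_of_le (by norm_num) ha₁2)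
      calc Real.log a₁ ≤ Real.log X :=
            Real.log_le_log ha₁0 ((Nat.floor_le (by linarith only [hX0])).trans
              (by linarith only [hX0]))
        _ ≤ 2 * L₁ := hlogX
    rw [hR1]
    linarith only [h1, h2, h3]
  -- §R1-main: Mertens
  have hM : ‖((b1 c' D : ℝ) : ℂ) * I * ((∑ q ∈ R1, Real.log q / q : ℝ) : ℂ) -
      ((b1 c' D : ℝ) : ℂ) * I * ((Real.log X - Real.log Y : ℝ) : ℂ)‖ ≤
      |b1 c' D| * (K + 1) := by
    have hmert := hK Y (X / 2) (by linarith only [hY16]) (by linarith only [hXY, hY16])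
    have hlogX2 : 2 ≤ Real.log (X / 2) := by
      have h16X : Real.log 16 ≤ Real.log (X / 2) :=
        Real.log_le_log (by norm_num) (by linarith only [hXY, hY16])
      have h16 : Real.log 16 = 4 * Real.log 2 := by
        rw [show (16 : ℝ) = 2 ^ 4 by norm_num, Real.log_pow]; norm_num
      linarith only [Real.log_two_gt_d9, h16X, h16]
    have hlogY2 : 2 ≤ Real.log Y := by linarith only [hlogY, hℓ3]
    have hK1 : K / Real.log (X / 2) ≤ K / 2 := div_le_div_of_nonneg_left hK0 (by norm_num) hlogX2
    have hK2 : K / Real.log Y ≤ K / 2 := div_le_div_of_nonneg_left hK0 (by norm_num) hlogY2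
    have hXdef : Real.log (X / 2) = Real.log X - Real.log 2 := Real.log_div hX0.ne' (by norm_num)
    rw [← mul_sub, ← Complex.ofReal_sub, norm_mul, norm_mul, Complex.norm_real, Complex.norm_I,
      mul_one, Complex.norm_real, Real.norm_eq_abs, Real.norm_eq_abs]
    refine mul_le_mul_of_nonneg_left ?_ (abs_nonneg _)
    have h := abs_le.mp hmert
    rw [← ha₀, ← ha₁, ← hR1] at h
    obtain ⟨h1, h2⟩ := h
    rw [abs_le]
    constructor <;>
      linarith only [h1, h2, hK1, hK2, hXdef, Real.log_two_lt_d9, Real.log_two_gt_d9, hK0]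
  -- §R1-linearisation error
  have hE₁ : ‖∑ q ∈ R1, (kappa2bar c' D q * (q : ℂ) ^ (-β) - ((b1 c' D : ℝ) : ℂ) * I * Real.log q) /
      (q : ℂ)‖ ≤ alpha D := by
    have hper : ∀ q ∈ R1, ‖(kappa2bar c' D q * (q : ℂ) ^ (-β) - ((b1 c' D : ℝ) : ℂ) * I * Real.log q) /
        (q : ℂ)‖ ≤ 3 * (A₀ * alpha D) ^ 2 * (2 * L₁) ^ 2 * ((1 : ℝ) / q) := by
      intro q hq
      obtain ⟨hqp, hq0, -, hlq, hsm⟩ := hmemR1 q hq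
      obtain ⟨-, -, hlin⟩ := window_term_facts c' D hβre hqp hsm
      have hqn : ‖(q : ℂ)‖ = q := by simp
      have hlq0 : 0 ≤ Real.log q := Real.log_natCast_nonneg q
      have hAq : 0 ≤ |b1 c' D| + |β.im| := by positivity
      rw [norm_div, hqn, div_eq_mul_one_div]
      refine mul_le_mul_of_nonneg_right (hlin.trans ?_) (by positivity)
      gcongr
    calc _ ≤ ∑ q ∈ R1, ‖(kappa2bar c' D q * (q : ℂ) ^ (-β) - ((b1 c' D : ℝ) : ℂ) * I * Real.log q) /
          (q : ℂ)‖ := norm_sum_le _ _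
      _ ≤ ∑ q ∈ R1, 3 * (A₀ * alpha D) ^ 2 * (2 * L₁) ^ 2 * ((1 : ℝ) / q) := Finset.sum_le_sum hper
      _ = 3 * (A₀ * alpha D) ^ 2 * (2 * L₁) ^ 2 * ∑ q ∈ R1, (1 : ℝ) / q := by rw [Finset.mul_sum]
      _ ≤ 3 * (A₀ * alpha D) ^ 2 * (2 * L₁) ^ 2 * (2 * L₁ + 4) :=
          mul_le_mul_of_nonneg_left hH (by positivity)
      _ ≤ alpha D := by
          -- `12 A₀² α L₁²(2L₁+4) ≤ 48πA₀²·𝓛⁶/𝓛⁹ ≤ 48πA₀²/𝓛 ≤ 1`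
          have h2 : 2 * L₁ + 4 ≤ 4 * ell D ^ 2 := by nlinarith only [hL₁2, hℓ3]
          have h6 : L₁ ^ 2 * (2 * L₁ + 4) ≤ 4 * ell D ^ 6 := by
            calc L₁ ^ 2 * (2 * L₁ + 4) ≤ (ell D ^ 2) ^ 2 * (4 * ell D ^ 2) := by
                  gcongr
              _ = 4 * ell D ^ 6 := by ring
          have key : 12 * A₀ ^ 2 * alpha D * (L₁ ^ 2 * (2 * L₁ + 4)) ≤ 1 := by
            rw [hα]
            calc 12 * A₀ ^ 2 * (π / ell D ^ 9) * (L₁ ^ 2 * (2 * L₁ + 4))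
                ≤ 12 * A₀ ^ 2 * (π / ell D ^ 9) * (4 * ell D ^ 6) := by gcongr
              _ = (48 * π * A₀ ^ 2) * ell D ^ 6 / ell D ^ 9 := by ring
              _ ≤ ell D * ell D ^ 6 / ell D ^ 9 := by gcongr
              _ ≤ 1 := by
                  rw [div_le_one (by positivity)]
                  calc ell D * ell D ^ 6 = ell D ^ 7 := by ring
                    _ ≤ ell D ^ 9 := pow_le_pow_right₀ hℓ1 (by norm_num)
          calc 3 * (A₀ * alpha D) ^ 2 * (2 * L₁) ^ 2 * (2 * L₁ + 4)
              = alpha D * (12 * A₀ ^ 2 * alpha D * (L₁ ^ 2 * (2 * L₁ + 4))) := by ring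
            _ ≤ alpha D * 1 := mul_le_mul_of_nonneg_left key hα0.le
            _ = alpha D := mul_one _
  -- §R1-cutoff error
  have hE₂ : ‖∑ q ∈ R1, kappa2bar c' D q * (q : ℂ) ^ (-β) * (((gstar D (X / q) - 1 : ℝ)) : ℂ) /
      (q : ℂ)‖ ≤ alpha D := by
    have hper : ∀ q ∈ R1, ‖kappa2bar c' D q * (q : ℂ) ^ (-β) * (((gstar D (X / q) - 1 : ℝ)) : ℂ) /
        (q : ℂ)‖ ≤ 2 * dlt * ((1 : ℝ) / q) := by
      intro q hq
      obtain ⟨hqp, hq0, hqX, -, hsm⟩ := hmemR1 q hq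
      obtain ⟨-, h2, -⟩ := window_term_facts c' D hβre hqp hsm
      have hqn : ‖(q : ℂ)‖ = q := by simp
      rw [norm_div, norm_mul, hqn, Complex.norm_real, Real.norm_eq_abs, div_eq_mul_one_div]
      refine mul_le_mul_of_nonneg_right ?_ (by positivity)
      exact mul_le_mul h2 (hgR1 q hq0 hqX) (abs_nonneg _) (by norm_num)
    calc _ ≤ ∑ q ∈ R1, ‖kappa2bar c' D q * (q : ℂ) ^ (-β) * (((gstar D (X / q) - 1 : ℝ)) : ℂ) /
          (q : ℂ)‖ := norm_sum_le _ _
      _ ≤ ∑ q ∈ R1, 2 * dlt * ((1 : ℝ) / q) := Finset.sum_le_sum hper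
      _ = 2 * dlt * ∑ q ∈ R1, (1 : ℝ) / q := by rw [Finset.mul_sum]
      _ ≤ 2 * dlt * (2 * L₁ + 4) := mul_le_mul_of_nonneg_left hH (by positivity)
      _ ≤ alpha D := by
          -- `dlt ≤ 2/𝓛³⁰` (`e^x ≥ 1 + x`, `log²2 ≥ 1/4`), `2L₁+4 ≤ 4𝓛²`, and `16𝓛²/𝓛³⁰ ≤ π/𝓛⁹`
          have hl2 : (1 : ℝ) / 4 ≤ Real.log 2 ^ 2 := by
            have h69 := Real.log_two_gt_d9; nlinarith only [h69]
          have hexp : ell D ^ 30 / 4 ≤ Real.exp (ell D ^ 30 * Real.log 2 ^ 2) := by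
            calc ell D ^ 30 / 4 ≤ ell D ^ 30 * Real.log 2 ^ 2 := by
                  rw [div_eq_mul_one_div]; exact mul_le_mul_of_nonneg_left hl2 hΛ.le
              _ ≤ ell D ^ 30 * Real.log 2 ^ 2 + 1 := by linarith only
              _ ≤ Real.exp (ell D ^ 30 * Real.log 2 ^ 2) := Real.add_one_le_exp _
          have hdltle : dlt ≤ 2 / ell D ^ 30 := by
            rw [hdlt, show -(ell D ^ 30) * Real.log 2 ^ 2 = -(ell D ^ 30 * Real.log 2 ^ 2) by ring,
              Real.exp_neg]
            have hpos : 0 < ell D ^ 30 / 4 := by positivity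
            calc (1 / 2 : ℝ) * (Real.exp (ell D ^ 30 * Real.log 2 ^ 2))⁻¹
                ≤ (1 / 2) * (ell D ^ 30 / 4)⁻¹ := by
                  gcongr
              _ = 2 / ell D ^ 30 := by field_simp; ring
          have h2 : 2 * L₁ + 4 ≤ 4 * ell D ^ 2 := by nlinarith only [hL₁2, hℓ3]
          calc 2 * dlt * (2 * L₁ + 4) ≤ 2 * (2 / ell D ^ 30) * (4 * ell D ^ 2) := by gcongr
            _ = 16 * ell D ^ 2 / ell D ^ 30 := by ring
            _ ≤ alpha D := by
                rw [hα, div_le_div_iff₀ (by positivity) (by positivity)]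
                have hℓ16 : 16 ≤ ell D := by nlinarith only [hℓB, Real.pi_gt_three, hA₀0]
                calc 16 * ell D ^ 2 * ell D ^ 9 = 16 * ell D ^ 11 := by ring
                  _ ≤ ell D * ell D ^ 11 := mul_le_mul_of_nonneg_right hℓ16 (by positivity)
                  _ = 1 * ell D ^ 12 := by ring
                  _ ≤ π * ell D ^ 30 :=
                      mul_le_mul (by linarith only [hπ3]) (pow_le_pow_right₀ hℓ1 (by norm_num)) (by positivity)
                        (by positivity)
  -- assembly
  rw [hS₃, add_zero, hsum1]
  have hb1B : |b1 c' D| * (K + 1) + |b1 c' D| * (2 + K) ≤ B₁ * alpha D * (2 * K + 3) := by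
    have : |b1 c' D| * (K + 1) + |b1 c' D| * (2 + K) = |b1 c' D| * (2 * K + 3) := by ring
    rw [this]
    exact mul_le_mul_of_nonneg_right hb1 (by linarith only [hK0])
  calc _ = ‖(((b1 c' D : ℝ) : ℂ) * I * ((∑ q ∈ R1, Real.log q / q : ℝ) : ℂ) -
            ((b1 c' D : ℝ) : ℂ) * I * ((Real.log X - Real.log Y : ℝ) : ℂ)) +
          (∑ q ∈ R1, (kappa2bar c' D q * (q : ℂ) ^ (-β) - ((b1 c' D : ℝ) : ℂ) * I * Real.log q) /
            (q : ℂ)) +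
          (∑ q ∈ R1, kappa2bar c' D q * (q : ℂ) ^ (-β) * (((gstar D (X / q) - 1 : ℝ)) : ℂ) / (q : ℂ)) +
          ∑ q ∈ (Finset.Ioc a₁ a₂).filter Nat.Prime, F q‖ := by
        congr 1; ring
    _ ≤ |b1 c' D| * (K + 1) + alpha D + alpha D + |b1 c' D| * (2 + K) := by
        refine (norm_add_le _ _).trans (add_le_add ((norm_add_le _ _).trans
          (add_le_add ((norm_add_le _ _).trans (add_le_add hM hE₁)) hE₂)) hS₂)
    _ ≤ (B₁ * (3 + 2 * K) + 2) * alpha D := by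
        have : (B₁ * (3 + 2 * K) + 2) * alpha D = B₁ * alpha D * (2 * K + 3) + 2 * alpha D := by ring
        rw [this]
        linarith only [hb1B]

end Literature.NumberTheory.LFunctions.Zhang2022.Typed.Section17
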